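/-
Copyright (c) 2026. All rights reserved.
Released under Apache 2.0 license as described in the file LICENSE.
Authors: HodgeCM publication cell (pub-hodgecm), GR lane, seat GR-1 (`pub-hodgecm-own-real34`).
-/
import Literature.NumberTheory.GelbartRogawski1991.QuadExtSplittingCharArchTwist
import HarnessLib

/-!
# The `det`-power twist at a SUB-FAMILY of `c`-fixed archimedean places (type (i) places of a general quadratic `E/F`)

Topic `NumberTheory/GelbartRogawski1991`; namespace `Literature.NumberTheory.GelbartRogawski1991.UnitaryDualPair.ArchSplitting.QuadExt`.
KERNEL only: proved theorems; no definition, no named fact, no `sorry`.  This is `QuadExtSplittingCharArchTwist`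
(`exists_archDetZPow`, `IsSplittingCharExt.exists_archDetTwist`, `IsSplittingCharExt.exists_archDetTwist_doubled`) RE-INDEXED:
there the family of `c`-fixed complex places `wOf` was indexed by ALL real places of `F` (adequate when `E` is totally complex);
for a general `E` the real places of `F` split into type (i) (`E_v = ℂ`, a `c`-fixed complex place `w(v)`) and type (ii)
(`E_v = ℝ × ℝ`), and the `det`-power twist lives on the type-(i) SUB-FAMILY only.  So here the index is an arbitrary finite
type `κ₁` (of record: `{v // IsTypeOne F E v}` with `wOf := placeAboveOne`, `Automorphic/QuadExtPlacesAbove`):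

* `exists_archDetZPow_sub` — `η_k(g) = ∏_{k ∈ κ₁} det(g_{w(k)})^{k_k}` is a continuous character of `U(J)(E ⊗ ℝ)`;
* **`IsSplittingCharExt.exists_archDetTwist_sub`** — for `χ` unitary with `χ|_{𝕀_F} = ε_{E/F}`: odd `e_k` with
  `χ_{w(k)}(y) = (σ y/|σ y|)^{e_k}`, `η = ∏_k det(g_{w(k)})^{(e_k+1)/2}`, and `η(g)² ∏_k det(g_{w(k)})⁻¹ = ∏_k χ_{w(k)}(u_{w(k)})²`
  whenever `σ(u_{w(k)})/σ(u_{w(k)})‾ = det g_{w(k)}`;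
* **`IsSplittingCharExt.exists_archDetTwist_doubled_sub`** — the same on the Siegel parabolic of the doubled group with
  `u = det_Δ (g,1)` (`det_archAt_mul_conj_eq`).

Statements and proofs are those of `QuadExtSplittingCharArchTwist`, letter for letter, with the index type generalised.
([Paul1998, §1.2 (1.2.1)–(1.2.2)]; [Liu2021, Remark 4.2]; [Kudla1994, §3]; [GelbartRogawski1991, §3.1 p. 456 (3.1.2)].)
Written for the stage-1 cell `pub-hodgecm` (seat GR-1); nothing here is a claim of the manuscripts adjudicated there.

## References

* [Paul1998] A. Paul, J. Funct. Anal. 159 (1998), §1.2 (1.2.1)–(1.2.2) p. 389.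
* [Liu2021] Y. Liu, Camb. J. Math. 9 (2021), §4.1 Remark 4.2.
* [Kudla1994] S. S. Kudla, Israel J. Math. 87 (1994), §3.
* [GelbartRogawski1991] S. Gelbart, J. Rogawski, Invent. Math. 105 (1991), §3.1 p. 456 (3.1.2).
* [BorelJacquet1979] A. Borel, H. Jacquet, PSPM 33.1 (1979), §4.1.
-/

set_option autoImplicit false

noncomputable section

open scoped NumberField Classical ComplexConjugate MatrixGroups
open NumberField NumberField.InfinitePlace IsDedekindDomain

open _root_.Literature.NumberTheory.Automorphic _root_.Literature.NumberTheory.Automorphic.UnitaryGroup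
open _root_.Literature.NumberTheory.GaloisRepresentations
open _root_.Literature.RepresentationTheory.HarrisKudlaSweet1996
open _root_.Literature.Analysis.Complex (unitPart coe_unitPart)
open _root_.Literature.NumberTheory.GelbartRogawski1991.AdaptedBlocks

namespace Literature.NumberTheory.GelbartRogawski1991.UnitaryDualPair.ArchSplitting.QuadExt

variable (F E : Type) [Field F] [NumberField F] [Field E] [NumberField E] [Algebra F E] [Algebra.IsQuadraticExtension F E]
  (c : E ≃ₐ[F] E) {N : ℕ} (J : Matrix (Fin N) (Fin N) E) (hc : c ≠ 1) {δ : E} (hcδ : c δ = -δ) (hδ : δ ≠ 0)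
  {κ₁ : Type*} [Fintype κ₁]
  (wOf : κ₁ → {w : InfinitePlace E // w.IsComplex})
  (hw : ∀ v, c • (wOf v).1 = (wOf v).1)

/-! ## §1 The `det`-power characters over the sub-family -/

omit [NumberField F] [NumberField E] [Algebra.IsQuadraticExtension F E] in
/-- **The `det`-power character `η_k(g) = ∏_v det(g_{wOf v})^{k_v}` of `U(J)(E ⊗ ℝ)`** (`g_w = archAt w g ∈ U(σ_w J)(ℂ)`,
integers `k_v`): a continuous homomorphism `U(J)(E ⊗ ℝ) → ℂˣ` — the INTEGER powers of `det` on the real unitary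
groups `U(σ_w J)(ℂ) ≅ U(p,q)`, i.e. the characters of [Paul1998, §1.2 (1.2.2) p. 389] that are trivial on the kernel
of the `det^{1/2}`-cover, composed with the place components `archAt w : U(J)(E ⊗ ℝ) → U(σ_w J)(ℂ)` of
`G(F ⊗ ℝ) = ∏_{v∣∞} G(F_v)` [BorelJacquet1979, §4.1] (continuous homomorphisms; `det` and integer powers are
continuous on `GL_N(ℂ)`). [cite: Paul1998, §1.2 (1.2.2) p. 389 L25–29] [cite: BorelJacquet1979, §4.1] -/
theorem exists_archDetZPow_sub (k : κ₁ → ℤ) :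
    ∃ η : arch F E c N J →* ℂˣ,
      (∀ g, ((η g : ℂˣ) : ℂ) =
        ∏ v : κ₁,
          (((archAt F E c N J (wOf v) (hw v) hc g : archLocal E N J (wOf v)) : GL (Fin N) ℂ) :
            Matrix (Fin N) (Fin N) ℂ).det ^ k v) ∧
      Continuous fun g => ((η g : ℂˣ) : ℂ) := by
  -- the homomorphism: product of `zpow (k v) ∘ det ∘ archAt (wOf v)`
  let d : κ₁ → (arch F E c N J →* ℂˣ) := fun v =>
    (zpowGroupHom (k v)).comp
      (Matrix.GeneralLinearGroup.det.comp
        ((archLocal E N J (wOf v)).subtype.comp (archAt F E c N J (wOf v) (hw v) hc)))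
  have hd : ∀ v g, ((d v g : ℂˣ) : ℂ) =
      (((archAt F E c N J (wOf v) (hw v) hc g : archLocal E N J (wOf v)) : GL (Fin N) ℂ) :
        Matrix (Fin N) (Fin N) ℂ).det ^ k v := by
    intro v g
    simp only [d, MonoidHom.coe_comp, Function.comp_apply, zpowGroupHom_apply, Subgroup.coe_subtype,
      Units.val_zpow_eq_zpow_val, Matrix.GeneralLinearGroup.val_det_apply]
  have hformula : ∀ g, (((∏ v, d v) g : ℂˣ) : ℂ) =
      ∏ v : κ₁,
        (((archAt F E c N J (wOf v) (hw v) hc g : archLocal E N J (wOf v)) : GL (Fin N) ℂ) :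
          Matrix (Fin N) (Fin N) ℂ).det ^ k v := by
    intro g
    rw [MonoidHom.finsetProd_apply, Units.coe_prod]
    exact Finset.prod_congr rfl fun v _ => hd v g
  refine ⟨∏ v, d v, hformula, ?_⟩
  -- continuity of the explicit formula
  have hcont : Continuous fun g : arch F E c N J =>
      ∏ v : κ₁,
        (((archAt F E c N J (wOf v) (hw v) hc g : archLocal E N J (wOf v)) : GL (Fin N) ℂ) :
          Matrix (Fin N) (Fin N) ℂ).det ^ k v := by
    refine continuous_finsetProd _ fun v _ => ?_
    have h1 : Continuous fun g : arch F E c N J =>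
        (((archAt F E c N J (wOf v) (hw v) hc g : archLocal E N J (wOf v)) : GL (Fin N) ℂ) :
          Matrix (Fin N) (Fin N) ℂ) :=
      Units.continuous_val.comp (continuous_subtype_val.comp (continuous_archAt F E c N J (wOf v) (hw v) hc))
    refine (h1.matrix_det).zpow₀ (k v) fun g => Or.inl ?_
    exact (Matrix.GeneralLinearGroup.det
      ((archAt F E c N J (wOf v) (hw v) hc g : archLocal E N J (wOf v)) : GL (Fin N) ℂ)).ne_zero
  exact hcont.congr fun g => (hformula g).symm


/-! ## §2 The twist of a splitting character over the sub-family -/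

/-- `(u^k)² · u⁻¹ = u^{2k−1}` for `u ≠ 0`. [folklore] -/
private theorem zpow_sq_mul_inv'' {u : ℂ} (hu : u ≠ 0) (k : ℤ) : (u ^ k) ^ 2 * u⁻¹ = u ^ (2 * k - 1) := by
  rw [zpow_sub_one₀ hu, two_mul, zpow_add₀ hu, sq]

/-- an odd integer `e` is `2k − 1` with `k = (e + 1)/2`. [folklore] -/
private theorem two_mul_add_one_ediv_two_sub_one'' {e : ℤ} (he : Odd e) : 2 * ((e + 1) / 2) - 1 = e := by
  obtain ⟨m, rfl⟩ := he
  omega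

omit [NumberField F] [NumberField E] [Algebra F E] [Algebra.IsQuadraticExtension F E] in
/-- `(σ y/|σ y|)^{e}`, squared, is `(σ y/σ y‾)^{e}`. [folklore] -/
private theorem unitPart_zpow_sq' (y : ℂˣ) (e : ℤ) :
    (((unitPart y : Circle) : ℂ) ^ e) ^ 2 = ((y : ℂ) / conj (y : ℂ)) ^ e := by
  rw [← zpow_natCast, ← zpow_mul, mul_comm, zpow_mul, zpow_natCast, coe_unitPart,
    HeckeCharacter.CMQuadraticExtension.div_norm_sq_eq_div_conj y.ne_zero]

include hc hcδ hδ hw in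
/-- **THE `det`-POWER TWIST AT THE `c`-FIXED ARCHIMEDEAN PLACES** (general quadratic `E/F`).  Let `χ` be a UNITARY Hecke character of
`E` with `χ|_{𝕀_F} = ε_{E/F}`, and `v ↦ w(v)` a family of `c`-fixed complex places of `E` over real places of `F`.  Then there are ODD
integers `e_v` with `χ_{w(v)}(y) = (σ_{w(v)} y/|σ_{w(v)} y|)^{e_v}` on `E_{w(v)}ˣ`, and the CONTINUOUS character
`η(g) = ∏_v det(g_{w(v)})^{(e_v+1)/2}` of `U(J)(E ⊗ ℝ)` (`g_w = archAt w g`), such that for every `g` and every idèle `u` of `E` with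
`σ(u_{w(v)})/σ(u_{w(v)})‾ = det g_{w(v)}` at each `v`:
`η(g)² · ∏_v det(g_{w(v)})⁻¹ = ∏_v χ_{w(v)}(u_{w(v)})²` (both sides are `∏_v det(g_{w(v)})^{e_v}`).
[cite: Paul1998, §1.2 (1.2.1)–(1.2.2) p. 389 L11–29] [cite: Liu2021, Remark 4.2] -/
theorem _root_.Literature.RepresentationTheory.HarrisKudlaSweet1996.IsSplittingCharExt.exists_archDetTwist_sub
    {χ : HeckeCharacter E} (hχu : χ.IsUnitary) (hχ : IsSplittingCharExt F E 1 χ) :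
    ∃ (e : κ₁ → ℤ) (η : arch F E c N J →* ℂˣ),
      (∀ v, Odd (e v)) ∧
      (∀ v (y : ((wOf v).1.Completion)ˣ), ((χ.archComponent (wOf v).1 y : ℂˣ) : ℂ) =
        ((unitPart (Units.map (Completion.extensionEmbedding (wOf v).1).toMonoidHom y) : Circle) : ℂ) ^ e v) ∧
      (∀ g, ((η g : ℂˣ) : ℂ) =
        ∏ v : κ₁,
          (((archAt F E c N J (wOf v) (hw v) hc g : archLocal E N J (wOf v)) : GL (Fin N) ℂ) :
            Matrix (Fin N) (Fin N) ℂ).det ^ ((e v + 1) / 2)) ∧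
      (Continuous fun g => ((η g : ℂˣ) : ℂ)) ∧
      ∀ (g : arch F E c N J) (u : ideleGroup E),
        (∀ v : κ₁,
          Completion.extensionEmbedding (wOf v).1 (((u : ideleGroup E) : AdeleRing (𝓞 E) E).1 (wOf v).1) /
              conj (Completion.extensionEmbedding (wOf v).1 (((u : ideleGroup E) : AdeleRing (𝓞 E) E).1 (wOf v).1)) =
            (((archAt F E c N J (wOf v) (hw v) hc g : archLocal E N J (wOf v)) : GL (Fin N) ℂ) :
              Matrix (Fin N) (Fin N) ℂ).det) →
        ((η g : ℂˣ) : ℂ) ^ 2 *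
            ∏ v : κ₁,
              ((((archAt F E c N J (wOf v) (hw v) hc g : archLocal E N J (wOf v)) : GL (Fin N) ℂ) :
                Matrix (Fin N) (Fin N) ℂ).det)⁻¹ =
          ∏ v : κ₁,
            ((χ.archComponent (wOf v).1 (QuadraticForms.ideleInfiniteComponent E (wOf v).1 u) : ℂˣ) : ℂ) ^ 2 := by
  -- the odd exponents, place by place (no CM theory)
  have hev : ∀ v : κ₁, ∃ e : ℤ, Odd e ∧ ∀ y : ((wOf v).1.Completion)ˣ,
      ((χ.archComponent (wOf v).1 y : ℂˣ) : ℂ) =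
        ((unitPart (Units.map (Completion.extensionEmbedding (wOf v).1).toMonoidHom y) : Circle) : ℂ) ^ e :=
    fun v => hχ.exists_odd_archComponent_eq_unitPart_zpow c (wOf v) hχu (hw v) hc hcδ hδ
  choose e hodd he using hev
  obtain ⟨η, hη, hηc⟩ := exists_archDetZPow_sub F E c J hc wOf hw fun v => (e v + 1) / 2
  refine ⟨e, η, hodd, he, hη, hηc, fun g u hu => ?_⟩
  -- shorthand for the determinants
  set d : κ₁ → ℂ := fun v =>
    (((archAt F E c N J (wOf v) (hw v) hc g : archLocal E N J (wOf v)) : GL (Fin N) ℂ) : Matrix (Fin N) (Fin N) ℂ).det with hd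
  have hd0 : ∀ v, d v ≠ 0 := fun v =>
    (Matrix.GeneralLinearGroup.det ((archAt F E c N J (wOf v) (hw v) hc g : archLocal E N J (wOf v)) : GL (Fin N) ℂ)).ne_zero
  rw [hη g, ← Finset.prod_pow, ← Finset.prod_mul_distrib]
  refine Finset.prod_congr rfl fun v _ => ?_
  rw [he v, unitPart_zpow_sq', zpow_sq_mul_inv'' (hd0 v), two_mul_add_one_ediv_two_sub_one'' (hodd v)]
  exact congrArg (fun z : ℂ => z ^ e v) (hu v).symm


/-! ## §3 On the Siegel parabolic of the doubled unitary group -/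

section Doubled

variable {n : ℕ} (T : Matrix (Fin n) (Fin n) F) (hT : IsUnit T.det) (JD : Matrix (Fin (n + n)) (Fin (n + n)) E)
  (hJD : JD = (Matrix.reindex finSumFinEquiv finSumFinEquiv (Matrix.fromBlocks T 0 0 (-T))).map (algebraMap F E))

include hT hJD hc hcδ hδ hw in
/-- **THE ARCHIMEDEAN TWIST ON THE SIEGEL PARABOLIC, general `E/F`, type-(i) places.**  For `χ` unitary with `χ|_{𝕀_F} = ε_{E/F}`,
`T ∈ GL_n(F)`, `J^𝔻 = e₂(T ⊕ −T)e₂ ⊗ E`, and a family `v ↦ w(v)` of `c`-fixed complex places: the continuous character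
`η = ∏_v det(g_{w(v)})^{(e_v+1)/2}` (`e_v` the odd exponents of `χ_{w(v)}`) satisfies, for every `g ∈ U(J^𝔻)(E ⊗ ℝ)` with
`(g,1) ∈ P_Δ` and every idèle `u` equal to Kudla's `x((g,1)) = det((g,1)|_Δ)`,
`η(g)² · ∏_v det(g_{w(v)})⁻¹ = ∏_v χ_{w(v)}(u_{w(v)})²` — the type-(i) factor of `χ(u)²`
(`QuadExt.apply_eq_prod_archComponent_of_snd_eq_one` + `prod_infinitePlace_eq_prod_placesOver` give the rest).
[cite: Kudla1994, §3] [cite: Paul1998, §1.2 (1.2.1)–(1.2.2) p. 389 L11–29] -/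
theorem _root_.Literature.RepresentationTheory.HarrisKudlaSweet1996.IsSplittingCharExt.exists_archDetTwist_doubled_sub
    {χ : HeckeCharacter E} (hχu : χ.IsUnitary) (hχ : IsSplittingCharExt F E 1 χ) :
    ∃ η : arch F E c (n + n) JD →* ℂˣ,
      (Continuous fun g => ((η g : ℂˣ) : ℂ)) ∧
      ∀ (g : arch F E c (n + n) JD) (u : ideleGroup E),
        (Matrix.reindex finSumFinEquiv.symm finSumFinEquiv.symm
              (((archToAdelic F E c (n + n) JD g).1 : GL (Fin (n + n)) (AdeleRing (𝓞 E) E)) :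
                Matrix (Fin (n + n)) (Fin (n + n)) (AdeleRing (𝓞 E) E))).toBlocks₁₁ +
            (Matrix.reindex finSumFinEquiv.symm finSumFinEquiv.symm
              (((archToAdelic F E c (n + n) JD g).1 : GL (Fin (n + n)) (AdeleRing (𝓞 E) E)) :
                Matrix (Fin (n + n)) (Fin (n + n)) (AdeleRing (𝓞 E) E))).toBlocks₁₂ =
          (Matrix.reindex finSumFinEquiv.symm finSumFinEquiv.symm
              (((archToAdelic F E c (n + n) JD g).1 : GL (Fin (n + n)) (AdeleRing (𝓞 E) E)) :
                Matrix (Fin (n + n)) (Fin (n + n)) (AdeleRing (𝓞 E) E))).toBlocks₂₁ +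
            (Matrix.reindex finSumFinEquiv.symm finSumFinEquiv.symm
              (((archToAdelic F E c (n + n) JD g).1 : GL (Fin (n + n)) (AdeleRing (𝓞 E) E)) :
                Matrix (Fin (n + n)) (Fin (n + n)) (AdeleRing (𝓞 E) E))).toBlocks₂₂ →
        ((u : ideleGroup E) : AdeleRing (𝓞 E) E) =
          ((Matrix.reindex finSumFinEquiv.symm finSumFinEquiv.symm
              (((archToAdelic F E c (n + n) JD g).1 : GL (Fin (n + n)) (AdeleRing (𝓞 E) E)) :
                Matrix (Fin (n + n)) (Fin (n + n)) (AdeleRing (𝓞 E) E))).toBlocks₁₁ +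
            (Matrix.reindex finSumFinEquiv.symm finSumFinEquiv.symm
              (((archToAdelic F E c (n + n) JD g).1 : GL (Fin (n + n)) (AdeleRing (𝓞 E) E)) :
                Matrix (Fin (n + n)) (Fin (n + n)) (AdeleRing (𝓞 E) E))).toBlocks₁₂).det →
        ((η g : ℂˣ) : ℂ) ^ 2 *
            ∏ v : κ₁,
              ((((archAt F E c (n + n) JD (wOf v) (hw v) hc g : archLocal E (n + n) JD (wOf v)) : GL (Fin (n + n)) ℂ) :
                Matrix (Fin (n + n)) (Fin (n + n)) ℂ).det)⁻¹ =
          ∏ v : κ₁,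
            ((χ.archComponent (wOf v).1 (QuadraticForms.ideleInfiniteComponent E (wOf v).1 u) : ℂˣ) : ℂ) ^ 2 := by
  obtain ⟨e, η, -, -, -, hηc, hη⟩ := hχ.exists_archDetTwist_sub F E c JD hc hcδ hδ wOf hw hχu
  refine ⟨η, hηc, fun g u hS hu => hη g u fun v => ?_⟩
  -- at `w = wOf v`: `σ_w(u_w) = x(g_w)` and `det g_w · conj x(g_w) = x(g_w)`
  set M : Matrix (Fin (n + n)) (Fin (n + n)) (AdeleRing (𝓞 E) E) :=
    (((archToAdelic F E c (n + n) JD g).1 : GL (Fin (n + n)) (AdeleRing (𝓞 E) E)) :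
      Matrix (Fin (n + n)) (Fin (n + n)) (AdeleRing (𝓞 E) E)) with hM
  have hφ : Completion.extensionEmbedding (wOf v).1 (((u : ideleGroup E) : AdeleRing (𝓞 E) E).1 (wOf v).1) =
      ((Matrix.reindex finSumFinEquiv.symm finSumFinEquiv.symm
          (((archAt F E c (n + n) JD (wOf v) (hw v) hc g : archLocal E (n + n) JD (wOf v)) : GL (Fin (n + n)) ℂ) :
            Matrix (Fin (n + n)) (Fin (n + n)) ℂ)).toBlocks₁₁ +
        (Matrix.reindex finSumFinEquiv.symm finSumFinEquiv.symm
          (((archAt F E c (n + n) JD (wOf v) (hw v) hc g : archLocal E (n + n) JD (wOf v)) : GL (Fin (n + n)) ℂ) :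
            Matrix (Fin (n + n)) (Fin (n + n)) ℂ)).toBlocks₁₂).det := by
    have h := map_det_deltaBlock_finSum ((Completion.extensionEmbedding (wOf v).1).comp
      ((Pi.evalRingHom (fun v : InfinitePlace E => v.Completion) (wOf v).1).comp (adeleFst E))) M
    rw [hM, map_placeEval_coe_archToAdelic F E c (n + n) JD (wOf v) (hw v) hc g] at h
    rw [← h, hu]
    rfl
  have hne : Completion.extensionEmbedding (wOf v).1 (((u : ideleGroup E) : AdeleRing (𝓞 E) E).1 (wOf v).1) ≠ 0 := by
    refine (map_ne_zero (Completion.extensionEmbedding (wOf v).1)).2 ?_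
    exact (QuadraticForms.ideleInfiniteComponent E (wOf v).1 u).ne_zero
  have hdet := det_archAt_mul_conj_eq F E c hc T hT JD hJD g hS (wOf v) (hw v)
  rw [← hφ] at hdet
  rw [eq_comm, eq_div_iff ((map_ne_zero (starRingEnd ℂ)).2 hne)]
  exact hdet

include hT hJD hc hcδ hδ hw in
/-- **the same, keeping the explicit formula** `η = ∏_k det(g_{w(k)})^{(e_k+1)/2}` (odd `e_k`) — needed to EVALUATE the
twist at the Levi sign representatives of the type-(ii) places (there `g_{w(k)} = 1`, so `η = 1`).
[cite: Kudla1994, §3] [cite: Paul1998, §1.2 (1.2.1)–(1.2.2) p. 389 L11–29] -/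
theorem _root_.Literature.RepresentationTheory.HarrisKudlaSweet1996.IsSplittingCharExt.exists_archDetTwist_doubled_sub'
    {χ : HeckeCharacter E} (hχu : χ.IsUnitary) (hχ : IsSplittingCharExt F E 1 χ) :
    ∃ (e : κ₁ → ℤ) (η : arch F E c (n + n) JD →* ℂˣ),
      (∀ v, Odd (e v)) ∧
      (∀ g, ((η g : ℂˣ) : ℂ) =
        ∏ v : κ₁,
          (((archAt F E c (n + n) JD (wOf v) (hw v) hc g : archLocal E (n + n) JD (wOf v)) : GL (Fin (n + n)) ℂ) :
            Matrix (Fin (n + n)) (Fin (n + n)) ℂ).det ^ ((e v + 1) / 2)) ∧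
      (Continuous fun g => ((η g : ℂˣ) : ℂ)) ∧
      ∀ (g : arch F E c (n + n) JD) (u : ideleGroup E),
        (Matrix.reindex finSumFinEquiv.symm finSumFinEquiv.symm
              (((archToAdelic F E c (n + n) JD g).1 : GL (Fin (n + n)) (AdeleRing (𝓞 E) E)) :
                Matrix (Fin (n + n)) (Fin (n + n)) (AdeleRing (𝓞 E) E))).toBlocks₁₁ +
            (Matrix.reindex finSumFinEquiv.symm finSumFinEquiv.symm
              (((archToAdelic F E c (n + n) JD g).1 : GL (Fin (n + n)) (AdeleRing (𝓞 E) E)) :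
                Matrix (Fin (n + n)) (Fin (n + n)) (AdeleRing (𝓞 E) E))).toBlocks₁₂ =
          (Matrix.reindex finSumFinEquiv.symm finSumFinEquiv.symm
              (((archToAdelic F E c (n + n) JD g).1 : GL (Fin (n + n)) (AdeleRing (𝓞 E) E)) :
                Matrix (Fin (n + n)) (Fin (n + n)) (AdeleRing (𝓞 E) E))).toBlocks₂₁ +
            (Matrix.reindex finSumFinEquiv.symm finSumFinEquiv.symm
              (((archToAdelic F E c (n + n) JD g).1 : GL (Fin (n + n)) (AdeleRing (𝓞 E) E)) :
                Matrix (Fin (n + n)) (Fin (n + n)) (AdeleRing (𝓞 E) E))).toBlocks₂₂ →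
        ((u : ideleGroup E) : AdeleRing (𝓞 E) E) =
          ((Matrix.reindex finSumFinEquiv.symm finSumFinEquiv.symm
              (((archToAdelic F E c (n + n) JD g).1 : GL (Fin (n + n)) (AdeleRing (𝓞 E) E)) :
                Matrix (Fin (n + n)) (Fin (n + n)) (AdeleRing (𝓞 E) E))).toBlocks₁₁ +
            (Matrix.reindex finSumFinEquiv.symm finSumFinEquiv.symm
              (((archToAdelic F E c (n + n) JD g).1 : GL (Fin (n + n)) (AdeleRing (𝓞 E) E)) :
                Matrix (Fin (n + n)) (Fin (n + n)) (AdeleRing (𝓞 E) E))).toBlocks₁₂).det →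
        ((η g : ℂˣ) : ℂ) ^ 2 *
            ∏ v : κ₁,
              ((((archAt F E c (n + n) JD (wOf v) (hw v) hc g : archLocal E (n + n) JD (wOf v)) : GL (Fin (n + n)) ℂ) :
                Matrix (Fin (n + n)) (Fin (n + n)) ℂ).det)⁻¹ =
          ∏ v : κ₁,
            ((χ.archComponent (wOf v).1 (QuadraticForms.ideleInfiniteComponent E (wOf v).1 u) : ℂˣ) : ℂ) ^ 2 := by
  obtain ⟨e, η, hodd, -, hηf, hηc, hη⟩ := hχ.exists_archDetTwist_sub F E c JD hc hcδ hδ wOf hw hχu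
  refine ⟨e, η, hodd, hηf, hηc, fun g u hS hu => hη g u fun v => ?_⟩
  -- at `w = wOf v`: `σ_w(u_w) = x(g_w)` and `det g_w · conj x(g_w) = x(g_w)`
  set M : Matrix (Fin (n + n)) (Fin (n + n)) (AdeleRing (𝓞 E) E) :=
    (((archToAdelic F E c (n + n) JD g).1 : GL (Fin (n + n)) (AdeleRing (𝓞 E) E)) :
      Matrix (Fin (n + n)) (Fin (n + n)) (AdeleRing (𝓞 E) E)) with hM
  have hφ : Completion.extensionEmbedding (wOf v).1 (((u : ideleGroup E) : AdeleRing (𝓞 E) E).1 (wOf v).1) =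
      ((Matrix.reindex finSumFinEquiv.symm finSumFinEquiv.symm
          (((archAt F E c (n + n) JD (wOf v) (hw v) hc g : archLocal E (n + n) JD (wOf v)) : GL (Fin (n + n)) ℂ) :
            Matrix (Fin (n + n)) (Fin (n + n)) ℂ)).toBlocks₁₁ +
        (Matrix.reindex finSumFinEquiv.symm finSumFinEquiv.symm
          (((archAt F E c (n + n) JD (wOf v) (hw v) hc g : archLocal E (n + n) JD (wOf v)) : GL (Fin (n + n)) ℂ) :
            Matrix (Fin (n + n)) (Fin (n + n)) ℂ)).toBlocks₁₂).det := by
    have h := map_det_deltaBlock_finSum ((Completion.extensionEmbedding (wOf v).1).comp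
      ((Pi.evalRingHom (fun v : InfinitePlace E => v.Completion) (wOf v).1).comp (adeleFst E))) M
    rw [hM, map_placeEval_coe_archToAdelic F E c (n + n) JD (wOf v) (hw v) hc g] at h
    rw [← h, hu]
    rfl
  have hne : Completion.extensionEmbedding (wOf v).1 (((u : ideleGroup E) : AdeleRing (𝓞 E) E).1 (wOf v).1) ≠ 0 := by
    refine (map_ne_zero (Completion.extensionEmbedding (wOf v).1)).2 ?_
    exact (QuadraticForms.ideleInfiniteComponent E (wOf v).1 u).ne_zero
  have hdet := det_archAt_mul_conj_eq F E c hc T hT JD hJD g hS (wOf v) (hw v)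
  rw [← hφ] at hdet
  rw [eq_comm, eq_div_iff ((map_ne_zero (starRingEnd ℂ)).2 hne)]
  exact hdet


end Doubled

end Literature.NumberTheory.GelbartRogawski1991.UnitaryDualPair.ArchSplitting.QuadExt

end
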